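import Summits.BirchSwinnertonDyer.Rank1Residual.Partition.Rows
import Literature.NumberTheory.EllipticCurves.Rank1Residual.Typed.Basic
import Literature.NumberTheory.EllipticCurves.Skinner2016.RankZeroPPart
import Literature.NumberTheory.EllipticCurves.AnalyticRankOrderProofs
import HarnessLib

/-!
# Route `ClassRecordThree` ∕ `KolyvaginRoadThree` (rung K2 at `p = 3`), crux `EulerHalvesAtThree`
# (item stmt-BirchSwinnertonDyer-19109): the registered stub TL₃ (`stub_twistLowerAtThree`) IS rung
# K6's object at `3` — the X11a lower half at `p = 3` — modulo Skinner 2016 Thm. C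
# (cell `bsd-stepL`, seat `bsd-stepL-mult-p3`, session g0; `--supports stmt-BirchSwinnertonDyer-19109`)

HONEST FRAMING (cell `bsd-stepL`, HOME `run/shared/lean/pub/bsd-stepL/`): the cell TYPES the rank-one
`p ∥ N` formula against tree objects and lands kernel glue between typed inputs; nothing here proves a
`p`-part of BSD for any curve; every theorem below is bookkeeping between predicates and NAMED published
facts taken as hypotheses (the PUB binder `Skinner2016.thmC_padicValRat_bsd_rank_zero` at `p = 3` carries
the tree flag `SU14-12.3.6-mu@nonsplit@3`, which travels with every use). Nothing is booked (T7).

WHAT THIS FILE RECORDS. The registered BC3 skeleton of item 19109 (`Cruxes/EulerHalvesAtThree/Lines/birth.lean`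
v3, sha 71f5c610…) carries the OPEN stub **TL₃** `stub_twistLowerAtThree` — "Skinner 2016 Thm. C's
inequality" `ord₃ (L(V,1)/Ω_V) ≤ ord₃ #Ш(V) + ord₃ ∏ c_ℓ(V) − 2·ord₃ #V(ℚ)_tors` for EVERY `V/ℚ` globally
minimal with multiplicative reduction at `3`, `V[3]` irreducible and `L(V,1) ≠ 0` — with NO (ram) binder
(its docstring: "(ram)-removal at 3 in rank 0"); the UB road (`…EulerHalvesAtThreeFromUBNotRam.lean`,
p528171) and the Jetchev line (`…JetchevMax.lean` §3) consume it verbatim on the `¬(ram) ∧ surj` clause.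
This file identifies TL₃ with EXISTING named objects:

* §1 `twistLowerAtThree_of_thmC_of_x11aLowerHalfAtThree`: TL₃ ⟸ Skinner 2016 Thm. C at `p = 3`
  (route support item 19381 `SkinnerRankZeroPPart`, BY NAME — it covers every `V` with a (ram) witness,
  with EQUALITY) + the X11a lower half AT `3`, `∀ V, ClassX11a V 3 → Typed.MissingLowerBoundAt V 3`
  (= rung K2's crux 19064 `ErratumRoadFive.X11aLowerHalf` READ AT `p = 3`; rung K6 ∕ B3's object — the
  (ram)-free main-conjecture lower bound at a multiplicative prime in analytic rank `0`) + GZK + modularity.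
* §2 `x11aLowerHalfAtThree_of_twistLowerAtThree`: conversely TL₃ ⟹ the X11a lower half at `3`
  (GZK + modularity only).
* §3 `twistLowerAtThree_iff_x11aLowerHalfAtThree`: hence, modulo {Thm. C@3, GZK, modularity},
  **TL₃ ⟺ X11a lower half at 3** — the stub's open content is EXACTLY the class-X11a problem at `p = 3`
  (`ClassX11a V 3 := r_an = 0 ∧ 3 ≠ 2 ∧ mult(3) ∧ irr(3) ∧ ¬ram(3)`; census row A9 ∕ N7 of the programme
  file at `p = 3`), no more and no less.

So the planner may replace TL₃ in any `_of` by the two named binders (19381 + 19064@3), and a proof of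
19064 (rung K6 ∕ the PRINT cell `bsd-print-x11a`) closes TL₃ at once; conversely no proof of TL₃ can avoid
proving the X11a lower half at `3`. Currency conversions are the tree's (`shaAn`, `leadingLCoeff`,
`regulator_eq_one_of_rank_zero`, `analyticRank_eq_zero_iff_holds`), as in tam3-p1's
`Koly.twistLowerAtThree_of_forall_bsdp` (`…TwistSupply.lean`).

References: [Skinner2016PacificMC] Thm. C (§1); [Miller2011LMS] Def. 1.1; [Darmon2004] Thm. 3.22;
[SkinnerUrban2014] Thm. 2 (the (ram) hypothesis); [GreenbergLNM1716] Conj. 1.11 (why ¬(ram) is open).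
-/

noncomputable section

open scoped Classical

namespace Summit.BirchSwinnertonDyer.Rank1Residual.X11b.Three.Koly

open WeierstrassCurve Literature.NumberTheory.EllipticCurves
  Literature.NumberTheory.EllipticCurves.Rank1Residual
  Literature.NumberTheory.EllipticCurves.Rank1Residual.Typed
  Summit.BirchSwinnertonDyer.Rank1Residual

/-! ### §0 Currency: `#Ш_an` versus `L(V,1)/Ω_V` in analytic rank `0` -/

/-- In analytic rank `0` (`L(V,1) ≠ 0`, modularity `hmod`, GZK `hGZK` for `Reg = 1`):
`#Ш(V)_an = (L(V,1)/Ω_V) · #V(ℚ)_tors² / ∏ c_ℓ` and `L(V,1)/Ω_V ≠ 0`. Bookkeeping on the tree's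
`shaAn`. [cite: Miller2011LMS, §1 (arXiv:1010.2431 p. 3)] [cite: Darmon2004, Thm. 3.22] -/
theorem shaAn_eq_lOverOmega_mul_of_L_one_ne_zero (hmod : hasEntireLFunction_rat)
    (hGZK : rank_eq_analyticRank_of_analyticRank_le_one)
    (V : WeierstrassCurve ℚ) [V.IsElliptic] (hL : V.entireLFunction 1 ≠ 0) :
    shaAn V = V.entireLFunction 1 / (V.realPeriodRat : ℂ) *
        ((V.torsionOrder : ℂ) ^ 2 / (V.tamagawaProduct : ℂ)) ∧
      V.entireLFunction 1 / (V.realPeriodRat : ℂ) ≠ 0 := by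
  have hr : V.analyticRank = 0 := (V.analyticRank_eq_zero_iff_holds (hmod V)).2 hL
  have hrank : V.mordellWeilRank = 0 := by
    have := (hGZK V (by omega)).1
    omega
  have hΩ : (V.realPeriodRat : ℂ) ≠ 0 := by exact_mod_cast V.realPeriodRat_pos_holds.ne'
  have hc : (V.tamagawaProduct : ℂ) ≠ 0 := by exact_mod_cast V.tamagawaProduct_pos_holds.ne'
  refine ⟨?_, div_ne_zero hL hΩ⟩
  rw [shaAn_def, V.regulator_eq_one_of_rank_zero hrank, leadingLCoeff_eq_of_analyticRank_eq_zero V hr]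
  push_cast
  field_simp

/-! ### §1 TL₃ from Skinner's Thm. C at `3` (on (ram) curves) and the X11a lower half at `3` (off (ram)) -/

/-- **TL₃ ⟸ {Skinner 2016 Thm. C at `p = 3`, X11a lower half at `3`} + GZK + modularity.** For `V/ℚ`
globally minimal, multiplicative at `3`, `V[3]` irreducible, `L(V,1) ≠ 0`: if `V` has a (ram) witness
(`Rank1Residual.Ram V 3`: a multiplicative `ℓ ≠ 3` with `3 ∤ v_ℓ(Δ_min)`), Skinner's Thm. C (`hSk`, the
PUB binder `Skinner2016.thmC_padicValRat_bsd_rank_zero`, printed range `3 ≤ p`; at `3` the flag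
`SU14-12.3.6-mu@nonsplit@3` travels) gives the print shape with EQUALITY; otherwise `(V,3) ∈ ClassX11a`
(`r_an = 0` by `analyticRank_eq_zero_iff`) and the X11a lower half at `3` (`hX11a`:
`ord₃ #Ш(V)_an ≤ ord₃ #Ш(V)`, rung K6's object = K2 crux 19064 read at `p = 3`) converts to the
print-shape inequality through §0. The conclusion is the registered stub `stub_twistLowerAtThree` of
item 19109 VERBATIM. CONDITIONAL on the binders; nothing booked.
[cite: Skinner2016PacificMC, Thm. C (§1)] [cite: Miller2011LMS, Def. 1.1] -/
theorem twistLowerAtThree_of_thmC_of_x11aLowerHalfAtThree (hmod : hasEntireLFunction_rat)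
    (hGZK : rank_eq_analyticRank_of_analyticRank_le_one)
    (hSk : Skinner2016.thmC_padicValRat_bsd_rank_zero)
    (hX11a : ∀ (V : WeierstrassCurve ℚ) [V.IsElliptic] [V.IsGloballyMinimal],
      ClassX11a V 3 → Typed.MissingLowerBoundAt V 3) :
    ∀ (V : WeierstrassCurve ℚ) [V.IsElliptic] [V.IsGloballyMinimal],
      V.HasMultiplicativeReductionAtPrime 3 → V.HasIrreducibleModPGaloisRep 3 →
      V.entireLFunction 1 ≠ 0 → Finite V.sha →
      ∃ q : ℚ, V.entireLFunction 1 / (V.realPeriodRat : ℂ) = (q : ℂ) ∧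
        padicValRat 3 q ≤ (padicValNat 3 V.shaOrder : ℤ) + padicValNat 3 V.tamagawaProduct -
          2 * padicValNat 3 V.torsionOrder := by
  intro V _ _ hmult hirr hL hfin
  by_cases hram : Ram V 3
  · -- (ram): Skinner's Thm. C at `p = 3`, with equality
    obtain ⟨q, hq, hv⟩ := hSk V 3 le_rfl (Or.inr hmult) hirr hram hL hfin
    exact ⟨q, hq, hv.le⟩
  · -- ¬(ram): `(V,3) ∈ ClassX11a`, and the lower half in Miller's currency converts
    have hr : V.analyticRank = 0 := (V.analyticRank_eq_zero_iff_holds (hmod V)).2 hL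
    have hX : ClassX11a V 3 := ⟨hr, by decide, hmult, hirr, hram⟩
    obtain ⟨q, hq, hv⟩ := hX11a V hX
    obtain ⟨hsha, hne⟩ := shaAn_eq_lOverOmega_mul_of_L_one_ne_zero hmod hGZK V hL
    have ht0 : (V.torsionOrder : ℚ) ≠ 0 := by exact_mod_cast V.torsionOrder_pos_holds.ne'
    have hc0 : (V.tamagawaProduct : ℚ) ≠ 0 := by exact_mod_cast V.tamagawaProduct_pos_holds.ne'
    have htc : ((V.torsionOrder : ℂ) ^ 2 / (V.tamagawaProduct : ℂ)) ≠ 0 := by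
      have ht : (V.torsionOrder : ℂ) ≠ 0 := by exact_mod_cast V.torsionOrder_pos_holds.ne'
      have hc : (V.tamagawaProduct : ℂ) ≠ 0 := by exact_mod_cast V.tamagawaProduct_pos_holds.ne'
      exact div_ne_zero (pow_ne_zero 2 ht) hc
    -- `q ≠ 0` since `#Ш_an ≠ 0`
    have hq0 : q ≠ 0 := by
      rintro rfl
      rw [Rat.cast_zero] at hq
      exact (mul_ne_zero hne htc) (hsha ▸ hq)
    refine ⟨q * (V.tamagawaProduct : ℚ) / (V.torsionOrder : ℚ) ^ 2, ?_, ?_⟩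
    · -- `L(V,1)/Ω = #Ш_an · ∏c / tors²`
      have : V.entireLFunction 1 / (V.realPeriodRat : ℂ) =
          shaAn V / ((V.torsionOrder : ℂ) ^ 2 / (V.tamagawaProduct : ℂ)) := by
        rw [hsha, mul_div_cancel_right₀ _ htc]
      rw [this, hq]
      have ht : (V.torsionOrder : ℂ) ≠ 0 := by exact_mod_cast V.torsionOrder_pos_holds.ne'
      have hc : (V.tamagawaProduct : ℂ) ≠ 0 := by exact_mod_cast V.tamagawaProduct_pos_holds.ne'
      push_cast
      field_simp
    · rw [padicValRat.div (mul_ne_zero hq0 hc0) (pow_ne_zero 2 ht0), padicValRat.mul hq0 hc0,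
        padicValRat.pow (V.torsionOrder : ℚ), padicValRat.of_nat, padicValRat.of_nat, Nat.cast_ofNat]
      linarith

/-! ### §2 Conversely: TL₃ gives the X11a lower half at `3` -/

/-- **TL₃ ⟹ the X11a lower half at `3`** (GZK for `Finite Ш` and `Reg = 1`, modularity for
`r_an = 0 ↔ L(V,1) ≠ 0`): at `(V,3) ∈ ClassX11a` the TL₃ inequality for `L(V,1)/Ω_V` is, through §0,
`ord₃ #Ш(V)_an ≤ ord₃ #Ш(V)` = `Typed.MissingLowerBoundAt V 3`. So TL₃ is AT LEAST as strong as rung K6's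
object at `3`. Bookkeeping; nothing booked. [cite: Miller2011LMS, Def. 1.1]
[cite: Skinner2016PacificMC, Thm. C (§1) — shape] -/
theorem x11aLowerHalfAtThree_of_twistLowerAtThree (hmod : hasEntireLFunction_rat)
    (hGZK : rank_eq_analyticRank_of_analyticRank_le_one)
    (hTL : ∀ (V : WeierstrassCurve ℚ) [V.IsElliptic] [V.IsGloballyMinimal],
      V.HasMultiplicativeReductionAtPrime 3 → V.HasIrreducibleModPGaloisRep 3 →
      V.entireLFunction 1 ≠ 0 → Finite V.sha →
      ∃ q : ℚ, V.entireLFunction 1 / (V.realPeriodRat : ℂ) = (q : ℂ) ∧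
        padicValRat 3 q ≤ (padicValNat 3 V.shaOrder : ℤ) + padicValNat 3 V.tamagawaProduct -
          2 * padicValNat 3 V.torsionOrder) :
    ∀ (V : WeierstrassCurve ℚ) [V.IsElliptic] [V.IsGloballyMinimal],
      ClassX11a V 3 → Typed.MissingLowerBoundAt V 3 := by
  intro V _ _ hX
  obtain ⟨hr, -, hmult, hirr, -⟩ := hX
  have hL : V.entireLFunction 1 ≠ 0 := (V.analyticRank_eq_zero_iff_holds (hmod V)).1 hr
  have hfin : Finite V.sha := (hGZK V (by omega)).2
  obtain ⟨q, hq, hv⟩ := hTL V hmult hirr hL hfin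
  obtain ⟨hsha, hne⟩ := shaAn_eq_lOverOmega_mul_of_L_one_ne_zero hmod hGZK V hL
  have ht0 : (V.torsionOrder : ℚ) ≠ 0 := by exact_mod_cast V.torsionOrder_pos_holds.ne'
  have hc0 : (V.tamagawaProduct : ℚ) ≠ 0 := by exact_mod_cast V.tamagawaProduct_pos_holds.ne'
  have hq0 : q ≠ 0 := by
    rintro rfl
    rw [Rat.cast_zero] at hq
    exact hne hq
  refine ⟨q * (V.torsionOrder : ℚ) ^ 2 / (V.tamagawaProduct : ℚ), ?_, ?_⟩
  · rw [hsha, hq]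
    push_cast
    ring
  · rw [padicValRat.div (mul_ne_zero hq0 (pow_ne_zero 2 ht0)) hc0,
      padicValRat.mul hq0 (pow_ne_zero 2 ht0), padicValRat.pow (V.torsionOrder : ℚ),
      padicValRat.of_nat, padicValRat.of_nat, Nat.cast_ofNat]
    linarith

/-! ### §3 The identification -/

/-- **TL₃ ⟺ the X11a lower half at `3`, modulo {Skinner 2016 Thm. C at `p = 3`, GZK, modularity}.**
The registered stub `stub_twistLowerAtThree` of item 19109 (both routes `ClassRecordThree` ∕
`KolyvaginRoadThree`) is equivalent, given the route support binder 19381 (`SkinnerRankZeroPPart` =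
`Skinner2016.thmC_padicValRat_bsd_rank_zero`) and the GZK ∕ modularity conjuncts of `PublishedInputsThree`,
to `∀ V, ClassX11a V 3 → Typed.MissingLowerBoundAt V 3` — rung K2's crux 19064 `X11aLowerHalf` read at
`p = 3` (rung K6's (ram)-free lower bound). Bookkeeping; nothing booked; no label moves.
[cite: Skinner2016PacificMC, Thm. C (§1)] [cite: Miller2011LMS, Def. 1.1] -/
theorem twistLowerAtThree_iff_x11aLowerHalfAtThree (hmod : hasEntireLFunction_rat)
    (hGZK : rank_eq_analyticRank_of_analyticRank_le_one)
    (hSk : Skinner2016.thmC_padicValRat_bsd_rank_zero) :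
    (∀ (V : WeierstrassCurve ℚ) [V.IsElliptic] [V.IsGloballyMinimal],
      V.HasMultiplicativeReductionAtPrime 3 → V.HasIrreducibleModPGaloisRep 3 →
      V.entireLFunction 1 ≠ 0 → Finite V.sha →
      ∃ q : ℚ, V.entireLFunction 1 / (V.realPeriodRat : ℂ) = (q : ℂ) ∧
        padicValRat 3 q ≤ (padicValNat 3 V.shaOrder : ℤ) + padicValNat 3 V.tamagawaProduct -
          2 * padicValNat 3 V.torsionOrder) ↔
    (∀ (V : WeierstrassCurve ℚ) [V.IsElliptic] [V.IsGloballyMinimal],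
      ClassX11a V 3 → Typed.MissingLowerBoundAt V 3) :=
  ⟨fun hTL V _ _ hX ↦ x11aLowerHalfAtThree_of_twistLowerAtThree hmod hGZK hTL V hX,
    fun hX11a V _ _ hmult hirr hL hfin ↦
      twistLowerAtThree_of_thmC_of_x11aLowerHalfAtThree hmod hGZK hSk hX11a V hmult hirr hL hfin⟩

end Summit.BirchSwinnertonDyer.Rank1Residual.X11b.Three.Koly

end
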